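import Literature.AnabelianGeometry.EtaleTheta.Discharge.Sec5GaloisShadowOfBaseShadow
import Literature.AnabelianGeometry.EtaleTheta.Discharge.Sec5TransportsOfBiKummerData

/-!
# [EtTh] Thm. 5.7 proof, the `Π^tp_Ÿ`-clause `hYdd` for the PRODUCED base shadow of `Ψ` (pp. 328–329, 331 / PDF pp. 102–103, 105)

Mochizuki, *The étale theta function …*, Publ. RIMS **45** (2009), proof of Thm. 5.6/5.7 p.328 l.−4 – p.329 l.1 (PDF pp.102–103):
"`Ψ` … induces a 1-compatible equivalence `Ψ^bs : D ⥲ D`, hence [cf. [SemiAnbd], Proposition 3.2] an outer automorphism of the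
tempered fundamental group … it follows from Propositions 2.4, 2.6 that `Ψ` preserves …"; §5 p.331 (PDF p.105) (`ρ`, the image of
`Π^tp_Ÿ` in `Aut_D(B_N^bs)`) [cite: MochizukiEtTh2009, Thm 5.6 proof p.328–329 (PDF pp.102–103)]; Cor. 2.18 (i) p.286 (PDF p.60).

PROOF-ONLY (no definitions, no new named facts).  abc-iut cell, layer L2, abc-iut-L2-lead RULINGS (R210) «Thm 5.7 hYdd₁ HAND»
(prover abc-iut-w5-d245), for abc-iut-L2-d4's Thm. 5.7 wiring (`Sec5Thm57OfConnectedTemperoidYddFamily`, binder `hdesc`, last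
conjunct `(… .atLevel 1).HB.map θ₁.toMonoidHom = (… .atLevel 1).HB`).  COMPOSITION of two landed pieces, nothing restated:
abc-iut-w5-d013's T56-L02 producers for the PRODUCED base shadow (`exists_galoisShadow_of_baseShadow`,
`exists_galoisShadow_cor218_of_baseShadow`: every `θA` with the base-shadow law is the Galois shadow of a topological `γ` of
`Π^tp_X`, [SemiAnbd] Prop. 3.2) and abc-iut-w5-d245's reduction `hYdd_ofBiKummerData_of_prop24` (p424854: `H_B := ρ(Π^tp_Ÿ)` is
`θ`-stable once `θ ∘ ρ = ρ ∘ γ` and `γ(Π^tp_Ÿ) = Π^tp_Ÿ`).  The Prop. 2.4/2.6 input is taken either in [EtTh] vocabulary as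
`hP24 : ∀ γ, γ(Π^tp_Ÿ) = Π^tp_Ÿ` (`ThetaEnvData`, any level structure) or BY NAME as abc-iut-L2-t2's `RigidData.Cor218_i`.
RESULTS: `hYdd_of_baseShadow_of_prop24`, `hYdd_of_baseShadow_cor218` (assembled data `ofBiKummerData` over `B^temp(Π^tp_X)⁰`,
temperoid Galois data `hg`, `σ` a section), and the literal instances `hYdd_ofConnectedTemperoidData_of_prop24` / `_cor218` at
abc-iut-L2-t4's `ofConnectedTemperoidData` (`hg`, `hσ` DISCHARGED) — with `θ₁ := θ_B := autBaseIsoAB⁻¹ ∘ θA ∘ autBaseIsoAB`, the SAME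
`θ_B` for which `exists_unit_transports_ofBiKummerData(_model)` (p427494/p428815) delivers `hstrv`, so one `θ₁` serves both conjuncts
of `hdesc`.  Nothing asserts that the §5 data exist for an actual curve; no side is taken on [IUTchIII] Cor. 3.12.
-/

noncomputable section

namespace Literature.AnabelianGeometry.EtaleTheta

open CategoryTheory Opposite Literature.AlgebraicGeometry.Frobenioids Literature.AnabelianGeometry.SemiGraphs
  Literature.AnabelianGeometry.SemiGraphs.GaloisObjects FrobenioidCyclotomicRigidity

namespace ThetaFrobenioid

universe u₀ v₀ w

section General

variable {K : Type u₀} [Field K] {X : SemiGraphs.TemperedArithmeticGroup.{u₀} K} {D₀ : Type u₀} [Category.{v₀} D₀]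
  {V : FrdIMonoidStub.{w}} {T₀ : RealifiedDivisorMonoids (D₀ := D₀) V}
  {VD : FrdICatStub.{u₀ + 1, u₀, w} (ConnectedPart (BTemp X.Pi))}
  {S : BiKummerSetting X T₀ (ConnectedPart (BTemp X.Pi)) VD}
  {pullFrac : ∀ {A A' : S.C} (_ : A' ⟶ A), S.biratUnits A → S.biratUnits A'}
  {lv N : ℕ+} {θ : S.biratUnits S.Aodot} {Bl : S.C} {Pl : S.FractionPair θ Bl} {Rl : S.NthRoot θ Pl lv pullFrac}

section AN

variable {T : ThetaEnvData.{max u₀ w} N}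
  (h : ModelFrobenioid.Hypotheses S.tf.divisorMonoid S.tf.ratFnFunctor)
  (toB : ∀ A : S.C, S.biratUnits A →* S.tf.biratUnitsModel A)
  (Q : FrobenioidTheta.ThetaSubquotientStub.{w} (ConnectedPart (BTemp X.Pi))) (odd_l : Odd (lv : ℕ))
  (R : S.NthRoot Rl.root Rl.pair N pullFrac) (ιX : T.PiX ≃ₜ* X.Pi)
  (hopen : IsOpen ((S.galoisSurj R.AN.base R.αData.isGalois).ker : Set X.Pi)) (σ : Aut R.AN.base →* Aut R.AN)
  (K' : Type w) [Field K'] (constEmb : K'ˣ →* S.tf.biratUnitsModel R.BN) (constEmb_injective : Function.Injective constEmb)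
  (hdivc : ∀ g : Aut R.BN.base,
    ModelFrobenioid.div ((σ ((BiKummerSetting.NthRoot.baseIso S R).conjAut.symm g)).hom ≫ R.pair.num) =
      ModelFrobenioid.div R.pair.num)
  (hdivp : ∀ y : T.PiYdd,
    ModelFrobenioid.div ((σ (S.galoisSurj R.AN.base R.αData.isGalois (ιX y.1))).hom ≫ R.pair.den) =
      ModelFrobenioid.div R.pair.den)

/-- **`hYdd` for the PRODUCED base shadow, Prop. 2.4 in [EtTh] vocabulary.**  At the assembled §5 data over `B^temp(Π^tp_X)⁰`
(temperoid Galois data `hg`; `σ = s^trv_N` a section): for `Ψ^bs` an equivalence with `eΨ`, `α : Ψ(A_N) ≅ A_N`, every `θA` with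
the base-shadow law `Base(α⁻¹Ψ(f)α) = θA(Base f)`, and "every topological automorphism of `Π^tp_X` stabilises `Π^tp_Ÿ`" (Prop. 2.4),
the subgroup `H_B = ρ(Π^tp_Ÿ) ⊆ Aut_D(B_N^bs)` is stable under `θ_B := autBaseIsoAB⁻¹ ∘ θA ∘ autBaseIsoAB` — the binder `hYdd` of
`cyclotomicRigidityPreserved_ofBiKummerData` / the last conjunct of abc-iut-L2-d4's `hdesc`.
[cite: MochizukiEtTh2009, Thm 5.6 proof p.328–329 (PDF pp.102–103)] -/
theorem hYdd_of_baseShadow_of_prop24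
    (hg : ∀ (A : ConnectedPart (BTemp X.Pi)) (hA : S.IsGaloisObj A), ∃ hA' : SemiGraphs.IsGaloisObj A.obj,
      ∀ g : X.Pi, (S.galoisSurj A hA g).hom.hom = (galoisSurjOf X.isTempered A.obj hA' g).hom)
    (hσ : ∀ g : Aut R.AN.base, ModelFrobenioid.baseMap (σ g).hom = g.hom)
    (Ψ : S.C ≌ S.C) (Ψbs : ConnectedPart (BTemp X.Pi) ⥤ ConnectedPart (BTemp X.Pi)) [Ψbs.IsEquivalence]
    (eΨ : Ψ.functor ⋙ (ofBiKummerData h toB Q odd_l R ιX hopen σ K' constEmb constEmb_injective hdivc hdivp).base ≅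
      (ofBiKummerData h toB Q odd_l R ιX hopen σ K' constEmb constEmb_injective hdivc hdivp).base ⋙ Ψbs)
    (α : Ψ.functor.obj (ofBiKummerData h toB Q odd_l R ιX hopen σ K' constEmb constEmb_injective hdivc hdivp).AN ≅
      (ofBiKummerData h toB Q odd_l R ιX hopen σ K' constEmb constEmb_injective hdivc hdivp).AN)
    (θA : Aut R.AN.base ≃* Aut R.AN.base)
    (hθ : ∀ f : Aut R.AN, (PreFrobenioid.baseFunctor S.F).mapIso (α.symm ≪≫ Ψ.functor.mapIso f ≪≫ α) =
        θA ((PreFrobenioid.baseFunctor S.F).mapIso f))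
    (hP24 : ∀ γ : T.PiX ≃ₜ* T.PiX, T.PiYdd.map γ.toMulEquiv.toMonoidHom = T.PiYdd) :
    (ofBiKummerData h toB Q odd_l R ιX hopen σ K' constEmb constEmb_injective hdivc hdivp).HB.map
        ((((ofBiKummerData h toB Q odd_l R ιX hopen σ K' constEmb constEmb_injective hdivc hdivp).autBaseIsoAB.symm.trans
            θA).trans
          (ofBiKummerData h toB Q odd_l R ιX hopen σ K' constEmb constEmb_injective hdivc hdivp).autBaseIsoAB).toMonoidHom) =
      (ofBiKummerData h toB Q odd_l R ιX hopen σ K' constEmb constEmb_injective hdivc hdivp).HB := by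
  obtain ⟨γ, hγ⟩ := exists_galoisShadow_of_baseShadow h toB Q odd_l R ιX hopen σ K' constEmb constEmb_injective hdivc hdivp hg hσ
    Ψ Ψbs eΨ α θA hθ
  exact hYdd_ofBiKummerData_of_prop24 h toB Q odd_l R ιX hopen σ K' constEmb constEmb_injective hdivc hdivp _ γ
    (fun y => hγ y) (hP24 γ)

end AN

section RD

variable {l' : ℕ} {RD : RigidData.{max u₀ w} N l'}
  (h : ModelFrobenioid.Hypotheses S.tf.divisorMonoid S.tf.ratFnFunctor)
  (toB : ∀ A : S.C, S.biratUnits A →* S.tf.biratUnitsModel A)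
  (Q : FrobenioidTheta.ThetaSubquotientStub.{w} (ConnectedPart (BTemp X.Pi))) (odd_l : Odd (lv : ℕ))
  (R : S.NthRoot Rl.root Rl.pair N pullFrac) (ιX : RD.PiX ≃ₜ* X.Pi)
  (hopen : IsOpen ((S.galoisSurj R.AN.base R.αData.isGalois).ker : Set X.Pi)) (σ : Aut R.AN.base →* Aut R.AN)
  (K' : Type w) [Field K'] (constEmb : K'ˣ →* S.tf.biratUnitsModel R.BN) (constEmb_injective : Function.Injective constEmb)
  (hdivc : ∀ g : Aut R.BN.base,
    ModelFrobenioid.div ((σ ((BiKummerSetting.NthRoot.baseIso S R).conjAut.symm g)).hom ≫ R.pair.num) =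
      ModelFrobenioid.div R.pair.num)
  (hdivp : ∀ y : RD.PiYdd,
    ModelFrobenioid.div ((σ (S.galoisSurj R.AN.base R.αData.isGalois (ιX y.1))).hom ≫ R.pair.den) =
      ModelFrobenioid.div R.pair.den)

/-- **`hYdd` for the PRODUCED base shadow, Prop. 2.4/2.6 through Cor. 2.18 (i) BY NAME** (abc-iut-L2-t2's `RigidData.Cor218_i`:
`Π^tp_Ÿ` is stable under every topological automorphism of `Π^tp_X`): as `hYdd_of_baseShadow_of_prop24`, over the §2 rigid data.
[cite: MochizukiEtTh2009, Thm 5.6 proof p.328–329 (PDF pp.102–103); Cor 2.18 (i) p.286 (PDF p.60)] -/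
theorem hYdd_of_baseShadow_cor218
    (hg : ∀ (A : ConnectedPart (BTemp X.Pi)) (hA : S.IsGaloisObj A), ∃ hA' : SemiGraphs.IsGaloisObj A.obj,
      ∀ g : X.Pi, (S.galoisSurj A hA g).hom.hom = (galoisSurjOf X.isTempered A.obj hA' g).hom)
    (hσ : ∀ g : Aut R.AN.base, ModelFrobenioid.baseMap (σ g).hom = g.hom) (h218 : RD.Cor218_i)
    (Ψ : S.C ≌ S.C) (Ψbs : ConnectedPart (BTemp X.Pi) ⥤ ConnectedPart (BTemp X.Pi)) [Ψbs.IsEquivalence]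
    (eΨ : Ψ.functor ⋙ (ofBiKummerData h toB Q odd_l R ιX hopen σ K' constEmb constEmb_injective hdivc hdivp).base ≅
      (ofBiKummerData h toB Q odd_l R ιX hopen σ K' constEmb constEmb_injective hdivc hdivp).base ⋙ Ψbs)
    (α : Ψ.functor.obj (ofBiKummerData h toB Q odd_l R ιX hopen σ K' constEmb constEmb_injective hdivc hdivp).AN ≅
      (ofBiKummerData h toB Q odd_l R ιX hopen σ K' constEmb constEmb_injective hdivc hdivp).AN)
    (θA : Aut R.AN.base ≃* Aut R.AN.base)
    (hθ : ∀ f : Aut R.AN, (PreFrobenioid.baseFunctor S.F).mapIso (α.symm ≪≫ Ψ.functor.mapIso f ≪≫ α) =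
        θA ((PreFrobenioid.baseFunctor S.F).mapIso f)) :
    (ofBiKummerData h toB Q odd_l R ιX hopen σ K' constEmb constEmb_injective hdivc hdivp).HB.map
        ((((ofBiKummerData h toB Q odd_l R ιX hopen σ K' constEmb constEmb_injective hdivc hdivp).autBaseIsoAB.symm.trans
            θA).trans
          (ofBiKummerData h toB Q odd_l R ιX hopen σ K' constEmb constEmb_injective hdivc hdivp).autBaseIsoAB).toMonoidHom) =
      (ofBiKummerData h toB Q odd_l R ιX hopen σ K' constEmb constEmb_injective hdivc hdivp).HB :=
  hYdd_of_baseShadow_of_prop24 h toB Q odd_l R ιX hopen σ K' constEmb constEmb_injective hdivc hdivp hg hσ Ψ Ψbs eΨ α θA hθ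
    fun γ => (h218 γ).2.1

end RD

end General

/-! ### The literal instances at abc-iut-L2-t4's `ThetaFrobenioid.ofConnectedTemperoidData` -/

section ConnectedTemperoidData

variable {K : Type u₀} [Field K] {X : SemiGraphs.TemperedArithmeticGroup.{u₀} K} {D₀ : Type u₀} [Category.{v₀} D₀]
  {V : FrdIMonoidStub.{w}} {T₀ : RealifiedDivisorMonoids (D₀ := D₀) V}
  {VD : FrdICatStub.{u₀ + 1, u₀, w} (ConnectedPart (BTemp X.Pi))}
  {tf : TemperedFrobenioid T₀ (ConnectedPart (BTemp X.Pi)) VD} {hZ : tf.monoidType = MonoidType.Z}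
  {hP : ∀ A : (ConnectedPart (BTemp X.Pi))ᵒᵖ, IsPerfect (tf.Φ.carrier A)}
  {NH : Subgroup (Field.absoluteGaloisGroup K) → tf.category → ℕ+ → Prop} {A₀ : tf.category}
  {hA₀ : PreFrobenioid.IsFrobeniusTrivial tf.toElem A₀} {hA₀' : SemiGraphs.IsGaloisObj A₀.base.obj}
  {lv N : ℕ+}
  {pullFrac : ∀ {A A' : (BiKummerSetting.mkOfConnectedTemperoid X tf hZ hP NH A₀ hA₀ hA₀').C} (_ : A' ⟶ A),
    (BiKummerSetting.mkOfConnectedTemperoid X tf hZ hP NH A₀ hA₀ hA₀').biratUnits A →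
      (BiKummerSetting.mkOfConnectedTemperoid X tf hZ hP NH A₀ hA₀ hA₀').biratUnits A'}
  {θ : (BiKummerSetting.mkOfConnectedTemperoid X tf hZ hP NH A₀ hA₀ hA₀').biratUnits
    (BiKummerSetting.mkOfConnectedTemperoid X tf hZ hP NH A₀ hA₀ hA₀').Aodot}
  {Bl : (BiKummerSetting.mkOfConnectedTemperoid X tf hZ hP NH A₀ hA₀ hA₀').C}
  {Pl : (BiKummerSetting.mkOfConnectedTemperoid X tf hZ hP NH A₀ hA₀ hA₀').FractionPair θ Bl}
  {Rl : (BiKummerSetting.mkOfConnectedTemperoid X tf hZ hP NH A₀ hA₀ hA₀').NthRoot θ Pl lv pullFrac}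
  (h : ModelFrobenioid.Hypotheses tf.divisorMonoid tf.ratFnFunctor)
  (Q : FrobenioidTheta.ThetaSubquotientStub.{w} (ConnectedPart (BTemp X.Pi))) (odd_l : Odd (lv : ℕ))
  (R : (BiKummerSetting.mkOfConnectedTemperoid X tf hZ hP NH A₀ hA₀ hA₀').NthRoot Rl.root Rl.pair N pullFrac)
  (K' : Type w) [Field K']

section TLevel

variable {T : ThetaEnvData.{max u₀ w} N} (ιX : T.PiX ≃ₜ* X.Pi) (constEmb : K'ˣ →* tf.biratUnitsModel R.BN)
  (constEmb_injective : Function.Injective constEmb)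
  (hinvc : ∀ g : Aut R.AN.base,
    pull tf.divisorMonoid g.hom (ModelFrobenioid.div R.pair.num) = ModelFrobenioid.div R.pair.num)
  (hinvp : ∀ y : T.PiX, y ∈ T.PiYdd →
    pull tf.divisorMonoid ((BiKummerSetting.mkOfConnectedTemperoid X tf hZ hP NH A₀ hA₀ hA₀').galoisSurj R.AN.base
      R.αData.isGalois (ιX y)).hom (ModelFrobenioid.div R.pair.den) = ModelFrobenioid.div R.pair.den)

/-- **`hYdd` at the genuine §5 data `ofConnectedTemperoidData`, Prop. 2.4 in [EtTh] vocabulary** (`hg`, `hσ` DISCHARGED: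
temperoid Galois data by construction, `σ := strvOfBiKummerData` a section by `baseMap_strvOfBiKummerData`); usable at any level
structure `T` (e.g. abc-iut-L2-d4's `𝒯.level ⟨1, _⟩` after `atLevel_ofConnectedTemperoidFamily_eq`).
[cite: MochizukiEtTh2009, Thm 5.6 proof p.328–329 (PDF pp.102–103)] -/
theorem hYdd_ofConnectedTemperoidData_of_prop24
    (Ψ : (BiKummerSetting.mkOfConnectedTemperoid X tf hZ hP NH A₀ hA₀ hA₀').C ≌
      (BiKummerSetting.mkOfConnectedTemperoid X tf hZ hP NH A₀ hA₀ hA₀').C)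
    (Ψbs : ConnectedPart (BTemp X.Pi) ⥤ ConnectedPart (BTemp X.Pi)) [Ψbs.IsEquivalence]
    (eΨ : Ψ.functor ⋙ (ofConnectedTemperoidData h Q odd_l R ιX K' constEmb constEmb_injective hinvc hinvp).base ≅
      (ofConnectedTemperoidData h Q odd_l R ιX K' constEmb constEmb_injective hinvc hinvp).base ⋙ Ψbs)
    (α : Ψ.functor.obj (ofConnectedTemperoidData h Q odd_l R ιX K' constEmb constEmb_injective hinvc hinvp).AN ≅
      (ofConnectedTemperoidData h Q odd_l R ιX K' constEmb constEmb_injective hinvc hinvp).AN)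
    (θA : Aut R.AN.base ≃* Aut R.AN.base)
    (hθ : ∀ f : Aut R.AN, (PreFrobenioid.baseFunctor (BiKummerSetting.mkOfConnectedTemperoid X tf hZ hP NH A₀ hA₀ hA₀').F).mapIso
        (α.symm ≪≫ Ψ.functor.mapIso f ≪≫ α) =
        θA ((PreFrobenioid.baseFunctor (BiKummerSetting.mkOfConnectedTemperoid X tf hZ hP NH A₀ hA₀ hA₀').F).mapIso f))
    (hP24 : ∀ γ : T.PiX ≃ₜ* T.PiX, T.PiYdd.map γ.toMulEquiv.toMonoidHom = T.PiYdd) :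
    (ofConnectedTemperoidData h Q odd_l R ιX K' constEmb constEmb_injective hinvc hinvp).HB.map
        ((((ofConnectedTemperoidData h Q odd_l R ιX K' constEmb constEmb_injective hinvc hinvp).autBaseIsoAB.symm.trans θA).trans
          (ofConnectedTemperoidData h Q odd_l R ιX K' constEmb constEmb_injective hinvc hinvp).autBaseIsoAB).toMonoidHom) =
      (ofConnectedTemperoidData h Q odd_l R ιX K' constEmb constEmb_injective hinvc hinvp).HB :=
  hYdd_of_baseShadow_of_prop24 h _ Q odd_l R ιX _ _ K' constEmb constEmb_injective _ _ (fun _ hA => ⟨hA, fun _ => rfl⟩)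
    (baseMap_strvOfBiKummerData h R) Ψ Ψbs eΨ α θA hθ hP24

end TLevel

section RDLevel

variable {l' : ℕ} {RD : RigidData.{max u₀ w} N l'} (ιX : RD.PiX ≃ₜ* X.Pi) (constEmb : K'ˣ →* tf.biratUnitsModel R.BN)
  (constEmb_injective : Function.Injective constEmb)
  (hinvc : ∀ g : Aut R.AN.base,
    pull tf.divisorMonoid g.hom (ModelFrobenioid.div R.pair.num) = ModelFrobenioid.div R.pair.num)
  (hinvp : ∀ y : RD.PiX, y ∈ RD.PiYdd →
    pull tf.divisorMonoid ((BiKummerSetting.mkOfConnectedTemperoid X tf hZ hP NH A₀ hA₀ hA₀').galoisSurj R.AN.base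
      R.αData.isGalois (ιX y)).hom (ModelFrobenioid.div R.pair.den) = ModelFrobenioid.div R.pair.den)

/-- **`hYdd` at the genuine §5 data `ofConnectedTemperoidData` over the §2 rigid data, Cor. 2.18 (i) BY NAME.**
[cite: MochizukiEtTh2009, Thm 5.6 proof p.328–329 (PDF pp.102–103); Cor 2.18 (i) p.286 (PDF p.60)] -/
theorem hYdd_ofConnectedTemperoidData_cor218 (h218 : RD.Cor218_i)
    (Ψ : (BiKummerSetting.mkOfConnectedTemperoid X tf hZ hP NH A₀ hA₀ hA₀').C ≌
      (BiKummerSetting.mkOfConnectedTemperoid X tf hZ hP NH A₀ hA₀ hA₀').C)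
    (Ψbs : ConnectedPart (BTemp X.Pi) ⥤ ConnectedPart (BTemp X.Pi)) [Ψbs.IsEquivalence]
    (eΨ : Ψ.functor ⋙ (ofConnectedTemperoidData h Q odd_l R ιX K' constEmb constEmb_injective hinvc hinvp).base ≅
      (ofConnectedTemperoidData h Q odd_l R ιX K' constEmb constEmb_injective hinvc hinvp).base ⋙ Ψbs)
    (α : Ψ.functor.obj (ofConnectedTemperoidData h Q odd_l R ιX K' constEmb constEmb_injective hinvc hinvp).AN ≅
      (ofConnectedTemperoidData h Q odd_l R ιX K' constEmb constEmb_injective hinvc hinvp).AN)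
    (θA : Aut R.AN.base ≃* Aut R.AN.base)
    (hθ : ∀ f : Aut R.AN, (PreFrobenioid.baseFunctor (BiKummerSetting.mkOfConnectedTemperoid X tf hZ hP NH A₀ hA₀ hA₀').F).mapIso
        (α.symm ≪≫ Ψ.functor.mapIso f ≪≫ α) =
        θA ((PreFrobenioid.baseFunctor (BiKummerSetting.mkOfConnectedTemperoid X tf hZ hP NH A₀ hA₀ hA₀').F).mapIso f)) :
    (ofConnectedTemperoidData h Q odd_l R ιX K' constEmb constEmb_injective hinvc hinvp).HB.map
        ((((ofConnectedTemperoidData h Q odd_l R ιX K' constEmb constEmb_injective hinvc hinvp).autBaseIsoAB.symm.trans θA).trans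
          (ofConnectedTemperoidData h Q odd_l R ιX K' constEmb constEmb_injective hinvc hinvp).autBaseIsoAB).toMonoidHom) =
      (ofConnectedTemperoidData h Q odd_l R ιX K' constEmb constEmb_injective hinvc hinvp).HB :=
  hYdd_ofConnectedTemperoidData_of_prop24 h Q odd_l R K' ιX constEmb constEmb_injective hinvc hinvp Ψ Ψbs eΨ α θA hθ
    fun γ => (h218 γ).2.1

end RDLevel

end ConnectedTemperoidData

end ThetaFrobenioid

end Literature.AnabelianGeometry.EtaleTheta

end
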